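/-
Copyright: cell pub-balaban-gaps, seat ne8 (estimate NE7c), gen 11. Project licence.
-/
import Summits.QuantumFields.BalabanUV.T4Continuum.Spine.NE7b.GaussianInducedMeanWindow

/-!
# Road (δ)'s LOWERED THRESHOLDS in the restricted-Gaussian currency of «LCS-j»: the restriction's large-field mass, the
# `(1 − η)⁻¹` price, the translated mass and the shifted moment AT LIVE LETTERS (row NE7c; junction J-7; kernel theorems)

Cell `pub-balaban-gaps` (G2), seat ne8, estimate **NE7c** (`T4IndicatorShell.ShellWeightBound` — an artefact of the cell's TWO-RUN
comparison with sharp cut-offs; NOT PRINTED in [Bałaban 1983–89]; NOT PROVED).  Nineteenth proof-only file under `Spine/NE7c/`;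
nothing of the NE7b lineage is edited (its theorems are consumed BY NAME); nothing of Bałaban's is named or asserted; zero `sorry`.

WHY.  Road (δ) (threshold randomisation, `Lit.T4ShellMeasure` §6–§8; member of record (δ-global-compact),
`Spine/NE7c/LiveFactorGlobalCompact`) runs ONE expansion whose small- and large-field thresholds are LOWERED by factors in `[λ₀, 1]`
(`λ₀ = 1 − β′`), and owes the (L1-step) census: every single-run bound must survive the lowering with assignment-free constants.
Files 15∕18 (`LiveFactorLCS`, `LiveFactorLCSWindow`) read the ONE-STEP END's rows `PointwiseExtraction ∕ LocCondStability` at live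
letters and recorded the STABILITY half as letter-blind GIVEN its exponent table `b`.  Since then the NE7b OWNER (t4-ne7b-p1 g105) and
gaps-ne6 g10 displayed the SUPPLIERS of `b` for Gaussian × small-field-χ kernels — `GaussianRestrictedMoment.restrictedMoment_le`
(price `(1 − η)⁻¹`, `η` = the restriction's large-field mass by `largeFieldMass_le`: union bound × tail over the conditions
`{θ_b ≤ xᵀQ_bx}`), `GaussianShiftedFibre.shiftedMoment_le(_of_inducedMean_le)` and `GaussianTranslatedMass.translatedLargeFieldMass_le ∕
shiftedMoment_le_of_inducedMeans` (the translated mass at thresholds `θ_b` against induced-mean energies), `GaussianInducedMeanDecay.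
inducedMeanEnergy_le_of_decay ∕ translatedMass_le` (energies from a decay letter, a buffer and the far small-field bound `V`),
`GaussianInducedMeanWindow.translatedMass_le_of_rowMargin` (row margins: `|m_b| ≤ θp`, far window `|x₂| ≤ p`).  THESE
SUPPLIERS SEE THE THRESHOLDS: `η` through `e^{−θ_b}`, the energies through `V`.  This file is their (L1-step) reading.

WHAT IS PROVED ([folklore]; per-event live factors `s_b` with `λ₀ ≤ s_b`, thresholds `θ_b ≥ 0`, quadratic dictionary `θ ↦ s²θ` as in
file 17's `integral_indicator_le_of_dominated_live`):
* §1 letters: `liveTailSum_le` (`Σ_b e^{−s_b²θ_b}·w_b ≤ Σ_b e^{−λ₀²θ_b}·w_b`), `liveTranslatedTailSum_le` (the same behind the Young shift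
  `(θ − (1+ε⁻¹)μ_b)∕(1+ε)`), `liveEta_le_half_of_threshold_large` (the sum at `λ₀` is `≤ 1∕2` once
  `log(2·#B) + r_b·log((√(1−δ))⁻¹) ≤ λ₀²θ_b` for every condition — ONE threshold-largeness clause seeing `λ₀`, the shape of file 2's
  `restrictedMass_lower_live` clause and of file 5's joint clause; in print the thresholds grow like `(log g_j⁻²)^{p}`, so it holds below
  one `g⋆(λ₀)`).
* §2 `largeFieldMass_le_live`: a restriction covered by conditions at LIVE thresholds `s_b²θ_b` has large-field mass
  `≤ (Σ_b e^{−λ₀²θ_b}(√(1−δ))⁻¹^{r_b})·∫e^{−xᵀSx}` — census class C8∕C1: a LOSS row (`× λ₀²` in the exponent), assignment-free bound.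
* §3 `restrictedMoment_le_live`: the OWNER's `(1 − η)⁻¹` price at the assignment-free `η(λ₀)`; `restrictedMoment_le_live_of_threshold_large`:
  below the clause the price is the CONSTANT `2·(√(1−δ_Q))⁻¹^r`, the same for every grid assignment.
* §4 `inducedMeanEnergy_le_of_decay_live`: the induced-mean energy bound at a LOWERED far small-field letter `t·V`, `0 ≤ t ≤ 1`, is
  print's bound verbatim (the energy only shrinks) — the far side is FREE; `translatedMass_le_live`, `shiftedMoment_le_of_inducedMeans_live`:
  the translated mass and the shifted restricted moment at live near thresholds with assignment-free energy letters `μ_b`, `B₀` — LOSS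
  `× λ₀²` on `θ_b` only, constants uniform over the grid; `translatedMass_le_of_rowMargin_live`: gaps-ne6 g10's WINDOW supplier
  (`GaussianInducedMeanWindow.translatedMass_le_of_rowMargin`, row margins ⟹ `|m_b| ≤ θp`) at a lowered far window `p′ ≤ p` (FREE) and live near
  thresholds (LOSS `× λ₀²`) — both patterns in one displayed row.
CONSEQUENCE for files 15∕18: the stability exponent these suppliers deliver at live letters,
`b_live = (1+ε⁻¹)B₀ + r·(−½log(1−δ′)) + log(1∕(1−η(λ₀)))` (or `+ log 2` below the clause), is ASSIGNMENT-FREE, so the uniform tables of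
`extractionLaws_of_LCS_live ∕ _keyPattern_live` are served by ONE `b` for the whole grid; in print's letters the same item is census class
C8 (restricted-Gaussian lower bounds, [B16] pp. 358∕380, [B14] (3.27)∕(3.32)) — kernel in file 2 `LiveFactorRestrictedGaussian` — now also in
the owner's model currency.  LOCATED ADDITION to the census (row 42, class C8, stability side): «the restriction's large-field mass `η` sees
the live thresholds; LOSS `× λ₀²`; absorbed below one threshold-largeness clause» — it corrects the wording «stability half letter-blind» of
file 15's header to «letter-blind GIVEN `b`; its Gaussian supplier's `η` is a C8 row, uniform below the clause».

NOT HERE (honest): the (R1″) readings for Bałaban's kernels (margins, decay of the small-field Green's function, maximum principle), the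
non-Gaussian remainder (R2), the identification (A3) — the (A1c) instance ∕ node O; the completeness of the (L1-step) census over
[B14]–[B16] (NOT PRINTED); NE7c itself.  VERDICT WORD UNCHANGED: WORK-bound behind node O; INSTANCE 0∕1.  NE7c ∕ NE7b NOT PRINTED ∕ NOT
PROVED; spine PROVED 0∕9; rung (B)+1 on ONE finite T⁴ — NOT ℝ⁴, NOT infinite volume, NOT the mass gap, NOT Clay.
HONEST DEPENDENCY (cell): continuum YM on T⁴ ⇐ BetaPertH ∧ nine spine estimates (0∕9 proved); BetaPertH ⇐ (D1) ∧ (D4) ∧ CAP+tail.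
-/

set_option autoImplicit false

namespace Summit.QuantumFields.BalabanUV.T4Continuum.Spine.NE7c.LiveFactorRestrictedMoment

open Matrix Finset MeasureTheory Real
open Summit.QuantumFields.BalabanUV.T4Continuum.NE7b.GaussianDominatedMoment
open Summit.QuantumFields.BalabanUV.T4Continuum.NE7b.GaussianRestrictedMoment
open Summit.QuantumFields.BalabanUV.T4Continuum.NE7b.GaussianShiftedFibre
open Summit.QuantumFields.BalabanUV.T4Continuum.NE7b.GaussianTranslatedMass
open Summit.QuantumFields.BalabanUV.T4Continuum.NE7b.GaussianInducedMeanDecay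
open Summit.QuantumFields.BalabanUV.T4Continuum.NE7b.GaussianInducedMeanWindow

/-! ## §1 Letters: union-bound tails at per-event live factors, and the threshold-largeness clause -/

section Letters

variable {ι : Type*}

/-- **LIVE UNION TAIL.**  With per-event live factors `λ₀ ≤ s_b` (`λ₀ ≥ 0`), thresholds `θ_b ≥ 0` and weights `w_b ≥ 0`:
`Σ_b e^{−s_b²θ_b}·w_b ≤ Σ_b e^{−λ₀²θ_b}·w_b` — the lowered thresholds cost the factor `λ₀²` in every exponent and nothing else
(census class C1∕C8; the right-hand side is assignment-free). [folklore] -/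
theorem liveTailSum_le (B : Finset ι) (θ w s : ι → ℝ) {lam₀ : ℝ} (h0 : 0 ≤ lam₀) (hs : ∀ b ∈ B, lam₀ ≤ s b)
    (hθ : ∀ b ∈ B, 0 ≤ θ b) (hw : ∀ b ∈ B, 0 ≤ w b) :
    ∑ b ∈ B, exp (-(s b ^ 2 * θ b)) * w b ≤ ∑ b ∈ B, exp (-(lam₀ ^ 2 * θ b)) * w b := by
  refine Finset.sum_le_sum fun b hb => mul_le_mul_of_nonneg_right (exp_le_exp.2 ?_) (hw b hb)
  have h1 : lam₀ ^ 2 * θ b ≤ s b ^ 2 * θ b := mul_le_mul_of_nonneg_right (pow_le_pow_left₀ h0 (hs b hb) 2) (hθ b hb)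
  linarith

/-- **LIVE UNION TAIL BEHIND THE YOUNG SHIFT** (the translated-mass exponents of `GaussianTranslatedMass ∕ GaussianInducedMeanDecay`):
`Σ_b e^{−(s_b²θ_b − a_b)∕(1+ε)}·w_b ≤ Σ_b e^{−(λ₀²θ_b − a_b)∕(1+ε)}·w_b` for `λ₀ ≤ s_b`, `θ_b ≥ 0`, `w_b ≥ 0`, `ε > 0` and ANY shifts `a_b`
(the induced-mean energies do not see the near thresholds). [folklore] -/
theorem liveTranslatedTailSum_le (B : Finset ι) (θ w s a : ι → ℝ) {lam₀ ε : ℝ} (h0 : 0 ≤ lam₀) (hs : ∀ b ∈ B, lam₀ ≤ s b)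
    (hθ : ∀ b ∈ B, 0 ≤ θ b) (hw : ∀ b ∈ B, 0 ≤ w b) (hε : 0 < ε) :
    ∑ b ∈ B, exp (-((s b ^ 2 * θ b - a b) / (1 + ε))) * w b ≤
      ∑ b ∈ B, exp (-((lam₀ ^ 2 * θ b - a b) / (1 + ε))) * w b := by
  refine Finset.sum_le_sum fun b hb => mul_le_mul_of_nonneg_right (exp_le_exp.2 ?_) (hw b hb)
  have h1 : lam₀ ^ 2 * θ b ≤ s b ^ 2 * θ b := mul_le_mul_of_nonneg_right (pow_le_pow_left₀ h0 (hs b hb) 2) (hθ b hb)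
  have h2 : (0 : ℝ) < 1 + ε := by linarith
  rw [neg_le_neg_iff, div_le_div_iff_of_pos_right h2]
  linarith

/-- **THE THRESHOLD-LARGENESS CLAUSE** (one located «thresholds large» condition that SEES `λ₀`): if every condition's threshold obeys
`log(2·#B) + r_b·log((√(1−δ))⁻¹) ≤ λ₀²·θ_b` (`δ < 1`), the live union tail is at most `1∕2`:
`Σ_b e^{−λ₀²θ_b}·(√(1−δ))⁻¹^{r_b} ≤ 1∕2`.  In print the thresholds are powers of `log g_j⁻²`, so the clause holds below one `g⋆(λ₀)`
(files 2∕5); here it is stated in the owner's letters. [folklore] -/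
theorem liveEta_le_half_of_threshold_large (B : Finset ι) (θ : ι → ℝ) (rb : ι → ℕ) {δ lam₀ : ℝ} (hδ : δ < 1)
    (hclause : ∀ b ∈ B, Real.log (2 * B.card) + rb b * Real.log ((√(1 - δ))⁻¹) ≤ lam₀ ^ 2 * θ b) :
    ∑ b ∈ B, exp (-(lam₀ ^ 2 * θ b)) * (√(1 - δ))⁻¹ ^ rb b ≤ 1 / 2 := by
  rcases B.eq_empty_or_nonempty with hB | hB
  · rw [hB, Finset.sum_empty]; norm_num
  have hc : 0 < (√(1 - δ))⁻¹ := inv_pos.2 (Real.sqrt_pos.2 (by linarith))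
  have hcard : (0 : ℝ) < B.card := Nat.cast_pos.2 hB.card_pos
  have h2c : (0 : ℝ) < 2 * B.card := by positivity
  have hterm : ∀ b ∈ B, exp (-(lam₀ ^ 2 * θ b)) * (√(1 - δ))⁻¹ ^ rb b ≤ (2 * (B.card : ℝ))⁻¹ := by
    intro b hb
    have hpow : (√(1 - δ))⁻¹ ^ rb b = exp (rb b * Real.log ((√(1 - δ))⁻¹)) := by
      rw [Real.exp_nat_mul, Real.exp_log hc]
    have h1 : exp (-(lam₀ ^ 2 * θ b)) ≤ exp (-(Real.log (2 * B.card) + rb b * Real.log ((√(1 - δ))⁻¹))) :=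
      exp_le_exp.2 (neg_le_neg (hclause b hb))
    have h2 : exp (-(Real.log (2 * B.card) + rb b * Real.log ((√(1 - δ))⁻¹))) * (√(1 - δ))⁻¹ ^ rb b =
        (2 * (B.card : ℝ))⁻¹ := by
      rw [hpow, ← Real.exp_add, show -(Real.log (2 * B.card) + rb b * Real.log ((√(1 - δ))⁻¹)) +
        rb b * Real.log ((√(1 - δ))⁻¹) = -Real.log (2 * B.card) by ring, Real.exp_neg, Real.exp_log h2c]
    calc exp (-(lam₀ ^ 2 * θ b)) * (√(1 - δ))⁻¹ ^ rb b
        ≤ exp (-(Real.log (2 * B.card) + rb b * Real.log ((√(1 - δ))⁻¹))) * (√(1 - δ))⁻¹ ^ rb b :=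
          mul_le_mul_of_nonneg_right h1 (pow_nonneg hc.le _)
      _ = (2 * (B.card : ℝ))⁻¹ := h2
  calc ∑ b ∈ B, exp (-(lam₀ ^ 2 * θ b)) * (√(1 - δ))⁻¹ ^ rb b ≤ ∑ b ∈ B, (2 * (B.card : ℝ))⁻¹ := Finset.sum_le_sum hterm
    _ = B.card * (2 * (B.card : ℝ))⁻¹ := by rw [Finset.sum_const, nsmul_eq_mul]
    _ = 1 / 2 := by field_simp

end Letters

/-! ## §2 The restriction's large-field mass at live thresholds (census class C8∕C1 — the LOSS row, assignment-free bound) -/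

section Gaussian

variable {n : Type*} [Fintype n] [DecidableEq n]

/-- **THE LARGE-FIELD MASS AT LIVE THRESHOLDS.**  `GaussianRestrictedMoment.largeFieldMass_le` BY NAME for a restriction whose defect is
covered by the conditions `{s_b²·θ_b ≤ xᵀQ_bx}` at LOWERED thresholds (`λ₀ ≤ s_b`, `λ₀ ≥ 0`, `θ_b ≥ 0`), then `liveTailSum_le`:
`∫ (1 − F) e^{−xᵀSx} ≤ (Σ_b e^{−λ₀²θ_b}·(√(1−δ))⁻¹^{r_b}) · ∫ e^{−xᵀSx}` — the bound does not see the assignment `s`. [folklore] -/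
theorem largeFieldMass_le_live {ι : Type*} (B : Finset ι) {S : Matrix n n ℝ} (Qb : ι → Matrix n n ℝ) (θ : ι → ℝ)
    (rb : ι → ℕ) {δ : ℝ} (hS : S.PosDef) (hQ : ∀ b ∈ B, (Qb b).PosSemidef) (hdom : ∀ b ∈ B, (δ • S - Qb b).PosSemidef)
    (hδ0 : 0 ≤ δ) (hδ : δ < 1) (hr : ∀ b ∈ B, (Qb b).rank ≤ rb b) {F : (n → ℝ) → ℝ} (hF1 : ∀ x, F x ≤ 1)
    (s : ι → ℝ) {lam₀ : ℝ} (h0 : 0 ≤ lam₀) (hs : ∀ b ∈ B, lam₀ ≤ s b) (hθ : ∀ b ∈ B, 0 ≤ θ b)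
    (hcov : ∀ x, 1 - F x ≤ ∑ b ∈ B, Set.indicator {x | s b ^ 2 * θ b ≤ x ⬝ᵥ (Qb b *ᵥ x)} (fun _ => (1 : ℝ)) x) :
    ∫ x, (1 - F x) * exp (-(x ⬝ᵥ (S *ᵥ x))) ≤
      (∑ b ∈ B, exp (-(lam₀ ^ 2 * θ b)) * (√(1 - δ))⁻¹ ^ rb b) * ∫ x, exp (-(x ⬝ᵥ (S *ᵥ x))) := by
  refine (largeFieldMass_le B Qb (fun b => s b ^ 2 * θ b) rb hS hQ hdom hδ0 hδ hr hF1 hcov).trans ?_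
  exact mul_le_mul_of_nonneg_right
    (liveTailSum_le B θ (fun b => (√(1 - δ))⁻¹ ^ rb b) s h0 hs hθ fun b _ => pow_nonneg (inv_nonneg.2 (Real.sqrt_nonneg _)) _)
    (integral_nonneg fun x => (exp_pos _).le)

/-! ## §3 The `(1 − η)⁻¹` price at the assignment-free `η(λ₀)` -/

/-- **THE RESTRICTED MOMENT AT LIVE LETTERS.**  `GaussianRestrictedMoment.restrictedMoment_le` BY NAME with its large-field mass `hmass`
DISCHARGED at live thresholds by `largeFieldMass_le_live`: for every assignment `s` of live factors (`λ₀ ≤ s_b`) and any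
`η₀ ≥ Σ_b e^{−λ₀²θ_b}(√(1−δ))⁻¹^{r_b}` with `η₀ < 1`,
`∫ F e^{xᵀQx} e^{−xᵀSx} ≤ ((√(1−δ_Q))⁻¹^r ∕ (1 − η₀)) · ∫ F e^{−xᵀSx}` — ONE constant for the whole grid. [folklore] -/
theorem restrictedMoment_le_live {ι : Type*} (B : Finset ι) {S Q : Matrix n n ℝ} (Qb : ι → Matrix n n ℝ) (θ : ι → ℝ)
    (rb : ι → ℕ) {δ δQ η₀ : ℝ} {r : ℕ} (hS : S.PosDef) (hQ : Q.PosSemidef) (hdomQ : (δQ • S - Q).PosSemidef)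
    (hδQ0 : 0 ≤ δQ) (hδQ : δQ < 1) (hrQ : Q.rank ≤ r)
    (hQb : ∀ b ∈ B, (Qb b).PosSemidef) (hdom : ∀ b ∈ B, (δ • S - Qb b).PosSemidef) (hδ0 : 0 ≤ δ) (hδ : δ < 1)
    (hr : ∀ b ∈ B, (Qb b).rank ≤ rb b) {F : (n → ℝ) → ℝ} (hF0 : ∀ x, 0 ≤ F x) (hF1 : ∀ x, F x ≤ 1)
    (hFm : AEStronglyMeasurable F volume) (s : ι → ℝ) {lam₀ : ℝ} (h0 : 0 ≤ lam₀) (hs : ∀ b ∈ B, lam₀ ≤ s b)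
    (hθ : ∀ b ∈ B, 0 ≤ θ b)
    (hcov : ∀ x, 1 - F x ≤ ∑ b ∈ B, Set.indicator {x | s b ^ 2 * θ b ≤ x ⬝ᵥ (Qb b *ᵥ x)} (fun _ => (1 : ℝ)) x)
    (hη₀ : ∑ b ∈ B, exp (-(lam₀ ^ 2 * θ b)) * (√(1 - δ))⁻¹ ^ rb b ≤ η₀) (hη : η₀ < 1) :
    ∫ x, F x * (exp (x ⬝ᵥ (Q *ᵥ x)) * exp (-(x ⬝ᵥ (S *ᵥ x)))) ≤
      ((√(1 - δQ))⁻¹ ^ r / (1 - η₀)) * ∫ x, F x * exp (-(x ⬝ᵥ (S *ᵥ x))) := by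
  refine restrictedMoment_le hS hQ hdomQ hδQ0 hδQ hrQ hF0 hF1 hFm hη ?_
  exact (largeFieldMass_le_live B Qb θ rb hS hQb hdom hδ0 hδ hr hF1 s h0 hs hθ hcov).trans
    (mul_le_mul_of_nonneg_right hη₀ (integral_nonneg fun x => (exp_pos _).le))

/-- **BELOW THE CLAUSE THE PRICE IS THE CONSTANT `2·(√(1−δ_Q))⁻¹^r`**, for EVERY assignment of live factors:
`restrictedMoment_le_live` at `η₀ = 1∕2` supplied by `liveEta_le_half_of_threshold_large`. [folklore] -/
theorem restrictedMoment_le_live_of_threshold_large {ι : Type*} (B : Finset ι) {S Q : Matrix n n ℝ} (Qb : ι → Matrix n n ℝ)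
    (θ : ι → ℝ) (rb : ι → ℕ) {δ δQ : ℝ} {r : ℕ} (hS : S.PosDef) (hQ : Q.PosSemidef) (hdomQ : (δQ • S - Q).PosSemidef)
    (hδQ0 : 0 ≤ δQ) (hδQ : δQ < 1) (hrQ : Q.rank ≤ r)
    (hQb : ∀ b ∈ B, (Qb b).PosSemidef) (hdom : ∀ b ∈ B, (δ • S - Qb b).PosSemidef) (hδ0 : 0 ≤ δ) (hδ : δ < 1)
    (hr : ∀ b ∈ B, (Qb b).rank ≤ rb b) {F : (n → ℝ) → ℝ} (hF0 : ∀ x, 0 ≤ F x) (hF1 : ∀ x, F x ≤ 1)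
    (hFm : AEStronglyMeasurable F volume) (s : ι → ℝ) {lam₀ : ℝ} (h0 : 0 ≤ lam₀) (hs : ∀ b ∈ B, lam₀ ≤ s b)
    (hθ : ∀ b ∈ B, 0 ≤ θ b)
    (hcov : ∀ x, 1 - F x ≤ ∑ b ∈ B, Set.indicator {x | s b ^ 2 * θ b ≤ x ⬝ᵥ (Qb b *ᵥ x)} (fun _ => (1 : ℝ)) x)
    (hclause : ∀ b ∈ B, Real.log (2 * B.card) + rb b * Real.log ((√(1 - δ))⁻¹) ≤ lam₀ ^ 2 * θ b) :
    ∫ x, F x * (exp (x ⬝ᵥ (Q *ᵥ x)) * exp (-(x ⬝ᵥ (S *ᵥ x)))) ≤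
      (2 * (√(1 - δQ))⁻¹ ^ r) * ∫ x, F x * exp (-(x ⬝ᵥ (S *ᵥ x))) := by
  have h := restrictedMoment_le_live B Qb θ rb hS hQ hdomQ hδQ0 hδQ hrQ hQb hdom hδ0 hδ hr hF0 hF1 hFm s h0 hs hθ hcov
    (liveEta_le_half_of_threshold_large B θ rb hδ hclause) (by norm_num : (1 : ℝ) / 2 < 1)
  have e : (√(1 - δQ))⁻¹ ^ r / (1 - 1 / 2) = 2 * (√(1 - δQ))⁻¹ ^ r := by ring
  rwa [e] at h

/-! ## §4 The far side is FREE; the translated mass and the shifted moment at live near thresholds -/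

/-- **THE INDUCED-MEAN ENERGY AT A LOWERED FAR SMALL-FIELD LETTER** (the far side of road (δ) is FREE):
`GaussianInducedMeanDecay.inducedMeanEnergy_le_of_decay` BY NAME when the exterior term obeys `|v_l| ≤ t·V` on the interface with a
live factor `t ≤ 1` — print's bound `q₀·#Z·(C·V·#D·e^{−μR})²` holds VERBATIM (the energy only shrinks with the far threshold), so the
displayed letter `B₀` is assignment-free. [folklore] -/
theorem inducedMeanEnergy_le_of_decay_live (S Q : Matrix n n ℝ) {C μ : ℝ} (d : n → n → ℝ) (hμ : 0 ≤ μ)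
    (hdec : ∀ i k, |S⁻¹ i k| ≤ C * Real.exp (-(μ * d i k)))
    (hQ : Q.PosSemidef) (Z : Finset n) (hQZ : ∀ i j, j ∉ Z → Q i j = 0) {q₀ : ℝ} (hq₀ : 0 ≤ q₀)
    (hQq : (q₀ • (1 : Matrix n n ℝ) - Q).PosSemidef)
    (D : Finset n) (v : n → ℝ) (hvD : ∀ l, l ∉ D → v l = 0) {V t : ℝ} (hV0 : 0 ≤ V) (ht1 : t ≤ 1)
    (hV : ∀ l ∈ D, |v l| ≤ t * V) {R : ℝ} (hR : ∀ i ∈ Z, ∀ l ∈ D, R ≤ d i l) :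
    (S⁻¹ *ᵥ v) ⬝ᵥ (Q *ᵥ (S⁻¹ *ᵥ v)) ≤ q₀ * Z.card * (C * V * (D.card * Real.exp (-(μ * R)))) ^ 2 := by
  have htV : t * V ≤ V := mul_le_of_le_one_left hV0 ht1
  exact inducedMeanEnergy_le_of_decay S Q d hμ hdec hQ Z hQZ hq₀ hQq D v hvD hV0 (fun l hl => (hV l hl).trans htV) hR

/-- **THE TRANSLATED LARGE-FIELD MASS AT LIVE NEAR THRESHOLDS.**  `GaussianInducedMeanDecay.translatedMass_le` (itself the OWNER's
`GaussianTranslatedMass.translatedLargeFieldMass_le` at energy letters `μ_b`) BY NAME for conditions at LOWERED thresholds `s_b²θ_b`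
(`λ₀ ≤ s_b`), then `liveTranslatedTailSum_le`: the translated restriction `F(· − w)` has large-field mass
`≤ (Σ_b e^{−(λ₀²θ_b − (1+ε⁻¹)μ_b)∕(1+ε)}·(√(1−δ))⁻¹^{r_b}) · ∫ e^{−uᵀSu}` — LOSS `× λ₀²` on the thresholds only; the energy letters
`μ_b` (assignment-free upper bounds, §4's far side) untouched. [folklore] -/
theorem translatedMass_le_live {ι : Type*} (B : Finset ι) {S : Matrix n n ℝ} (Qb : ι → Matrix n n ℝ) (θ μb : ι → ℝ)
    (rb : ι → ℕ) {δ : ℝ} (hS : S.PosDef) (hQ : ∀ b ∈ B, (Qb b).PosSemidef)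
    (hdom : ∀ b ∈ B, (δ • S - Qb b).PosSemidef) (hδ0 : 0 ≤ δ) (hδ : δ < 1) (hr : ∀ b ∈ B, (Qb b).rank ≤ rb b)
    {F : (n → ℝ) → ℝ} (hF1 : ∀ x, F x ≤ 1) (s : ι → ℝ) {lam₀ : ℝ} (h0 : 0 ≤ lam₀) (hs : ∀ b ∈ B, lam₀ ≤ s b)
    (hθ : ∀ b ∈ B, 0 ≤ θ b)
    (hcov : ∀ x, 1 - F x ≤ ∑ b ∈ B, Set.indicator {x | s b ^ 2 * θ b ≤ x ⬝ᵥ (Qb b *ᵥ x)} (fun _ => (1 : ℝ)) x)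
    (w : n → ℝ) (hm : ∀ b ∈ B, w ⬝ᵥ (Qb b *ᵥ w) ≤ μb b) {ε : ℝ} (hε : 0 < ε) :
    ∫ u, (1 - F (u - w)) * exp (-(u ⬝ᵥ (S *ᵥ u))) ≤
      (∑ b ∈ B, exp (-((lam₀ ^ 2 * θ b - (1 + ε⁻¹) * μb b) / (1 + ε))) * (√(1 - δ))⁻¹ ^ rb b) *
        ∫ u, exp (-(u ⬝ᵥ (S *ᵥ u))) := by
  refine (translatedMass_le B Qb (fun b => s b ^ 2 * θ b) μb rb hS hQ hdom hδ0 hδ hr hF1 hcov w hm hε).trans ?_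
  exact mul_le_mul_of_nonneg_right
    (liveTranslatedTailSum_le B θ (fun b => (√(1 - δ))⁻¹ ^ rb b) s (fun b => (1 + ε⁻¹) * μb b) h0 hs hθ
      (fun b _ => pow_nonneg (inv_nonneg.2 (Real.sqrt_nonneg _)) _) hε)
    (integral_nonneg fun u => (exp_pos _).le)

/-- **THE SHIFTED RESTRICTED MOMENT AT LIVE LETTERS** (the OWNER's `GaussianShiftedFibre.shiftedMoment_le_of_inducedMean_le` BY NAME,
its `hmass` discharged by `translatedMass_le_live` at the induced mean `w = S⁻¹v`).  For EVERY assignment `s` of live factors, with the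
assignment-free letters `μ_b ≥ mᵀQ_bm`, `B₀ ≥ mᵀQm` (`m = S⁻¹v`) and
`η ≥ Σ_b e^{−(λ₀²θ_b − (1+ε⁻¹)μ_b)∕(1+ε)}(√(1−δ))⁻¹^{r_b}`, `η < 1`:
`∫ F e^{xᵀQx} e^{−(xᵀSx + 2xᵀv)} ≤ [e^{(1+ε⁻¹)B₀}·(√(1−δ′))⁻¹^r ∕ (1 − η)] · ∫ F e^{−(xᵀSx + 2xᵀv)}` — ONE constant for the grid: the
stability exponent `b_live = (1+ε⁻¹)B₀ + r·(−½log(1−δ′)) + log(1∕(1−η))` served to files 15∕18's uniform tables. [folklore] -/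
theorem shiftedMoment_le_of_inducedMeans_live {ι : Type*} (B : Finset ι) {S Q : Matrix n n ℝ} (Qb : ι → Matrix n n ℝ)
    (θ μb : ι → ℝ) (rb : ι → ℕ) {δ δ' ε η B₀ : ℝ} {r : ℕ} (hS : S.PosDef) (hQ : Q.PosSemidef) (hε : 0 < ε)
    (hdom : (δ' • S - (1 + ε) • Q).PosSemidef) (hδ'0 : 0 ≤ δ') (hδ' : δ' < 1) (hr : Q.rank ≤ r)
    (hQb : ∀ b ∈ B, (Qb b).PosSemidef) (hdomb : ∀ b ∈ B, (δ • S - Qb b).PosSemidef) (hδ0 : 0 ≤ δ) (hδ : δ < 1)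
    (hrb : ∀ b ∈ B, (Qb b).rank ≤ rb b) (v : n → ℝ) {F : (n → ℝ) → ℝ} (hF0 : ∀ x, 0 ≤ F x) (hF1 : ∀ x, F x ≤ 1)
    (hFm : Measurable F) (s : ι → ℝ) {lam₀ : ℝ} (h0 : 0 ≤ lam₀) (hs : ∀ b ∈ B, lam₀ ≤ s b) (hθ : ∀ b ∈ B, 0 ≤ θ b)
    (hcov : ∀ x, 1 - F x ≤ ∑ b ∈ B, Set.indicator {x | s b ^ 2 * θ b ≤ x ⬝ᵥ (Qb b *ᵥ x)} (fun _ => (1 : ℝ)) x)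
    (hm : ∀ b ∈ B, (S⁻¹ *ᵥ v) ⬝ᵥ (Qb b *ᵥ (S⁻¹ *ᵥ v)) ≤ μb b) (hB : (S⁻¹ *ᵥ v) ⬝ᵥ (Q *ᵥ (S⁻¹ *ᵥ v)) ≤ B₀)
    (hη : η < 1)
    (hηb : ∑ b ∈ B, exp (-((lam₀ ^ 2 * θ b - (1 + ε⁻¹) * μb b) / (1 + ε))) * (√(1 - δ))⁻¹ ^ rb b ≤ η) :
    ∫ x, F x * (exp (x ⬝ᵥ (Q *ᵥ x)) * exp (-(x ⬝ᵥ (S *ᵥ x) + 2 * (x ⬝ᵥ v)))) ≤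
      (exp ((1 + ε⁻¹) * B₀) * ((√(1 - δ'))⁻¹ ^ r / (1 - η))) * ∫ x, F x * exp (-(x ⬝ᵥ (S *ᵥ x) + 2 * (x ⬝ᵥ v))) := by
  refine shiftedMoment_le_of_inducedMean_le hS hQ hε hdom hδ'0 hδ' hr v hF0 hF1 hFm hη ?_ hB
  refine (translatedMass_le_live B Qb θ μb rb hS hQb hdomb hδ0 hδ hrb hF1 s h0 hs hθ hcov (S⁻¹ *ᵥ v) hm hε).trans ?_
  exact mul_le_mul_of_nonneg_right hηb (integral_exp_neg_qf_pos hS).le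

/-- **THE WINDOW SUPPLIER AT LIVE LETTERS** (gaps-ne6 g10's `GaussianInducedMeanWindow.translatedMass_le_of_rowMargin`, p363526, BY NAME):
the translated restriction's large-field mass under row margins, with the far field in a LOWERED window `|x₂ a| ≤ p′`, `0 ≤ p′ ≤ p` (FREE:
the nesting letters `q_b·#Z_b·(θp)²` at print's `p` stand) and the near conditions at LIVE thresholds `s_b²θ_b`, `λ₀ ≤ s_b` (LOSS `× λ₀²`):
`∫ (1 − F(u − m)) e^{−uᵀSu} ≤ (Σ_b e^{−(λ₀²θ_b − (1+ε⁻¹)q_b#Z_b(θp)²)∕(1+ε)}(√(1−δ))⁻¹^{r_b}) · ∫ e^{−uᵀSu}`, `m = S⁻¹S₁₂x₂` — both patterns of this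
file in one displayed row; the bound does not see `(s, p′)`. [folklore] -/
theorem translatedMass_le_of_rowMargin_live {m ι : Type*} [Fintype m] (B : Finset ι) {S : Matrix n n ℝ} (hS : S.PosDef)
    (α : n → ℝ) (hα : ∀ i, 0 < α i) (hmar : ∀ i, α i + ∑ k ∈ univ.erase i, |S i k| ≤ |S i i|)
    (S₁₂ : Matrix n m ℝ) (N : Finset m) (hcol : ∀ l a, S₁₂ l a ≠ 0 → a ∈ N) (x₂ : m → ℝ) {p p' θ : ℝ}
    (hp' : 0 ≤ p') (hp'p : p' ≤ p) (hθ : 0 ≤ θ) (hx : ∀ a ∈ N, |x₂ a| ≤ p') (hs : ∀ i, ∑ a, |S₁₂ i a| ≤ θ * α i)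
    (Qb : ι → Matrix n n ℝ) (θb : ι → ℝ) (rb : ι → ℕ) (Zb : ι → Finset n) (qb : ι → ℝ) {δ : ℝ}
    (hQ : ∀ b ∈ B, (Qb b).PosSemidef) (hdom : ∀ b ∈ B, (δ • S - Qb b).PosSemidef) (hδ0 : 0 ≤ δ) (hδ : δ < 1)
    (hr : ∀ b ∈ B, (Qb b).rank ≤ rb b) (hQZ : ∀ b ∈ B, ∀ i j, j ∉ Zb b → Qb b i j = 0)
    (hQq : ∀ b ∈ B, (qb b • (1 : Matrix n n ℝ) - Qb b).PosSemidef) (hqb : ∀ b ∈ B, 0 ≤ qb b)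
    {F : (n → ℝ) → ℝ} (hF1 : ∀ x, F x ≤ 1) (s : ι → ℝ) {lam₀ : ℝ} (h0 : 0 ≤ lam₀) (hsl : ∀ b ∈ B, lam₀ ≤ s b)
    (hθb : ∀ b ∈ B, 0 ≤ θb b)
    (hcov : ∀ x, 1 - F x ≤ ∑ b ∈ B, Set.indicator {x | s b ^ 2 * θb b ≤ x ⬝ᵥ (Qb b *ᵥ x)} (fun _ => (1 : ℝ)) x)
    {ε : ℝ} (hε : 0 < ε) :
    ∫ u, (1 - F (u - S⁻¹ *ᵥ (S₁₂ *ᵥ x₂))) * exp (-(u ⬝ᵥ (S *ᵥ u))) ≤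
      (∑ b ∈ B, exp (-((lam₀ ^ 2 * θb b - (1 + ε⁻¹) * (qb b * (Zb b).card * (θ * p) ^ 2)) / (1 + ε))) *
          (√(1 - δ))⁻¹ ^ rb b) * ∫ u, exp (-(u ⬝ᵥ (S *ᵥ u))) := by
  have hp : 0 ≤ p := hp'.trans hp'p
  refine (translatedMass_le_of_rowMargin B hS α hα hmar S₁₂ N hcol x₂ hp hθ (fun a ha => (hx a ha).trans hp'p) hs Qb
    (fun b => s b ^ 2 * θb b) rb Zb qb hQ hdom hδ0 hδ hr hQZ hQq hqb hF1 hcov hε).trans ?_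
  exact mul_le_mul_of_nonneg_right
    (liveTranslatedTailSum_le B θb (fun b => (√(1 - δ))⁻¹ ^ rb b) s (fun b => (1 + ε⁻¹) * (qb b * (Zb b).card * (θ * p) ^ 2))
      h0 hsl hθb (fun b _ => pow_nonneg (inv_nonneg.2 (Real.sqrt_nonneg _)) _) hε)
    (integral_nonneg fun u => (exp_pos _).le)

end Gaussian

/-! ## §5 A decided instance of the clause -/

/-- TOY: one condition (`#B = 1`), rank letter `r_b = 0`, `δ = 0`, `λ₀ = 1∕2`, threshold `θ = 4`: the clause reads `log 2 + 0 ≤ ¼·4 = 1`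
(true since `log 2 < 1`), and `liveEta_le_half_of_threshold_large` gives `e^{−1}·1 ≤ 1∕2`. [folklore] -/
example : ∑ b ∈ ({0} : Finset ℕ), exp (-((1 / 2 : ℝ) ^ 2 * (fun _ => (4 : ℝ)) b)) * (√(1 - (0 : ℝ)))⁻¹ ^ (fun _ => 0) b
    ≤ 1 / 2 := by
  refine liveEta_le_half_of_threshold_large ({0} : Finset ℕ) (fun _ => (4 : ℝ)) (fun _ => 0) (by norm_num) fun b _ => ?_
  have hlog : Real.log 2 < 1 := by
    have := Real.log_two_lt_d9
    linarith
  simp only [Finset.card_singleton, Nat.cast_one, mul_one, Nat.cast_zero, zero_mul, add_zero]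
  norm_num
  linarith

end Summit.QuantumFields.BalabanUV.T4Continuum.Spine.NE7c.LiveFactorRestrictedMoment
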